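import Literature.Probability.LatticeModels.GHSInequality
import Literature.Probability.LatticeModels.IsingFieldVolume
import Literature.Probability.LatticeModels.IsingFKG
import HarnessLib

/-!
# GHS: truncated plus correlations increase with the volume

Topic `Probability/LatticeModels`, namespace `Literature.Probability.LatticeModels`.

A classical consequence of the GHS inequality `u₃ ≤ 0` (Griffiths–Hurst–Sherman 1970; Lebowitz,
Comm. Math. Phys. 35 (1974) 87, eq. (1.8) and §2, Remark (ii): for nonnegative fields the truncated
pair function `⟨σ_x;σ_y⟩ = ⟨σ_xσ_y⟩ - ⟨σ_x⟩⟨σ_y⟩` is nonincreasing in each external field) for the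
finite-volume Ising model with `+` boundary condition, `β ≥ 0`, uniform field `h ≥ 0`, on an
arbitrary locally finite graph:

  `⟨σ_x;σ_y⟩⁺_{Λ₁;β,h} ≤ ⟨σ_x;σ_y⟩⁺_{Λ₂;β,h}`   (`x, y ∈ Λ₁ ⊆ Λ₂`)

(`isingTrunc_plus_mono_volume`): the `+` boundary spins of `Λ₂ ∖ Λ₁` act as infinite nonnegative
fields. This is the truncated companion of the GKS antitonicity of plain plus correlations in the
volume (`isingCorr_plus_le_of_subset`, Friedli–Velenik 2017, Exercise 3.12 / Lemma 3.22) and is the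
input that bounds finite-volume plus susceptibilities `β⁻¹ ∂_h ⟨σ₀⟩⁺_{Λ;β,h} = Σ_x ⟨σ₀;σ_x⟩⁺_{Λ;β,h}`
by their infinite-volume limits.

Proof given here (discrete, one site at a time, no limit of fields). For `z ∉ Λ'` the plus state of
`Λ'` is the plus state of `Λ = insert z Λ'` conditioned on `σ_z = +1` — the spatial Markov property,
Friedli–Velenik 2017, eq. (3.26), in the tree as `fieldExpect_fixed_eq_cond` — i.e.
`⟨F⟩⁺_{Λ'} (1 + ⟨σ_z⟩⁺_Λ) = ⟨F⟩⁺_Λ + ⟨F σ_z⟩⁺_Λ` (`isingExpect_plus_cond`). Writing the truncated pair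
function of `Λ'` in terms of `Λ`-expectations, the inequality `⟨σ_x;σ_y⟩⁺_{Λ'} ≤ ⟨σ_x;σ_y⟩⁺_Λ`
becomes, after clearing the denominator `(1 + ⟨σ_z⟩)² > 0`, the identity
`RHS - LHS = -(1 + ⟨σ_z⟩) u₃(x,y,z) + ⟨σ_x;σ_z⟩⟨σ_y;σ_z⟩ ≥ 0` by GHS (tree `isingExpect_ghs`) and
GKS II / FKG (`⟨σ_x;σ_z⟩ ≥ 0`, tree `ising_fkg_holds`) (`trunc_cond_le_aux`,
`isingTrunc_plus_le_insert`); induction on `Λ₂ ∖ Λ₁` concludes. What is NOT here: the infinite-volume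
statement (immediate from the existence of the plus state on local observables) and site-dependent
fields.

## References

* J. L. Lebowitz, *GHS and other inequalities*, Comm. Math. Phys. 35 (1974) 87–92, eq. (1.8),
  §2 Remark (ii) [Lebowitz1974].
* R. B. Griffiths, C. A. Hurst, S. Sherman, J. Math. Phys. 11 (1970) 790 [GriffithsHurstSherman1970].
* S. Friedli, Y. Velenik, *Statistical Mechanics of Lattice Systems* (CUP 2017), §3.6.3 eq. (3.26),
  Lemma 3.22, Exercise 3.12 [FriedliVelenik2017].
-/

noncomputable section

open Finset MeasureTheory

namespace Literature.Probability.LatticeModels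

variable {V : Type*} [DecidableEq V] (G : SimpleGraph V) [G.LocallyFinite]

omit [DecidableEq V] in
/-- With `+` outside, agreement with the boundary condition on the single new site `z ∉ Λ'` of
`insert z Λ' ∖ Λ' = {z}` is the observable `(1 + σ_z)/2`. [folklore] -/
theorem agreeIndicator_insert_sdiff [DecidableEq V] {Λ' : Finset V} {z : V} (hz : z ∉ Λ')
    (σ : SpinConfig V) : agreeIndicator (insert z Λ' \ Λ') 1 σ = 2⁻¹ * (1 + spinAt z σ) := by
  have hD : ∀ w, w ∈ insert z Λ' \ Λ' ↔ w = z := fun w => by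
    rw [Finset.mem_sdiff, Finset.mem_insert]
    constructor
    · rintro ⟨hw | hw, hw'⟩
      · exact hw
      · exact absurd hw hw'
    · rintro rfl
      exact ⟨Or.inl rfl, hz⟩
  have hiff : (∀ w ∈ insert z Λ' \ Λ', σ w = (1 : SpinConfig V) w) ↔ σ z = 1 := by
    simp only [hD, forall_eq, Pi.one_apply]
  unfold agreeIndicator
  rw [if_congr hiff rfl rfl]
  rcases Int.units_eq_one_or (σ z) with h1 | h1
  · rw [if_pos h1]
    simp [spinAt, h1]
    norm_num
  · rw [if_neg (by rw [h1]; decide)]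
    simp [spinAt, h1]

/-- The conditioning event `σ_z = +1` has positive plus probability:
`0 < 1 + ⟨σ_z⟩⁺_{insert z Λ';β,h}` (Friedli–Velenik 2017, eq. (3.26), denominator).
[cite: FriedliVelenik2017, §3.6.3 eq. (3.26)] -/
theorem one_add_isingExpect_spinAt_pos {Λ' : Finset V} {z : V} (hz : z ∉ Λ') (β h : ℝ) :
    0 < 1 + isingExpect G (insert z Λ') β h .plus (spinAt z) := by
  have hsub : Λ' ⊆ insert z Λ' := Finset.subset_insert z Λ'
  have hpos := fieldExpect_agreeIndicator_pos G hsub (1 : SpinConfig V) β (fun _ => h)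
  have hbc : (BoundaryCondition.fixed 1 : BoundaryCondition V) = .plus := rfl
  have hden : agreeIndicator (insert z Λ' \ Λ') (1 : SpinConfig V) =
      fun σ => 2⁻¹ * ((fun _ => (1 : ℝ)) σ + spinAt z σ) := funext (agreeIndicator_insert_sdiff hz)
  have mz := measurable_spinAt (V := V) z
  have m2 : Measurable (fun σ => (fun _ => (1 : ℝ)) σ + spinAt z σ) := measurable_const.add mz
  rw [fieldExpect_const, hbc, hden, isingExpect_const_mul' _ _ _ _ β _ m2,
    isingExpect_add' _ _ _ _ β measurable_const mz, isingExpect_const] at hpos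
  linarith [hpos]

/-- **Conditioning on one plus spin** (the spatial Markov property, Friedli–Velenik 2017, §3.6.3,
eq. (3.26): `μ⁺_Λ(· | σ_i = +1 ∀ i ∈ Λ∖Δ) = μ⁺_Δ(·)`, here with `Λ ∖ Δ = {z}`): for `z ∉ Λ'` and
measurable `F`, `⟨F⟩⁺_{Λ';β,h} (1 + ⟨σ_z⟩⁺_{Λ;β,h}) = ⟨F⟩⁺_{Λ;β,h} + ⟨F σ_z⟩⁺_{Λ;β,h}`,
`Λ = insert z Λ'`. [cite: FriedliVelenik2017, §3.6.3 eq. (3.26)] -/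
theorem isingExpect_plus_cond {Λ' : Finset V} {z : V} (hz : z ∉ Λ') (β h : ℝ)
    {F : SpinConfig V → ℝ} (hF : Measurable F) :
    isingExpect G Λ' β h .plus F * (1 + isingExpect G (insert z Λ') β h .plus (spinAt z)) =
      isingExpect G (insert z Λ') β h .plus F +
        isingExpect G (insert z Λ') β h .plus (fun σ => F σ * spinAt z σ) := by
  have hsub : Λ' ⊆ insert z Λ' := Finset.subset_insert z Λ'
  have hcond := fieldExpect_fixed_eq_cond G hsub (1 : SpinConfig V) β (fun _ => h) hF
  have hbc : (BoundaryCondition.fixed 1 : BoundaryCondition V) = .plus := rfl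
  rw [fieldExpect_const, fieldExpect_const, fieldExpect_const, hbc] at hcond
  have hnum : (fun σ => F σ * agreeIndicator (insert z Λ' \ Λ') 1 σ) =
      fun σ => 2⁻¹ * (F σ + F σ * spinAt z σ) := by
    funext σ; rw [agreeIndicator_insert_sdiff hz]; ring
  have hden : agreeIndicator (insert z Λ' \ Λ') (1 : SpinConfig V) =
      fun σ => 2⁻¹ * ((fun _ => (1 : ℝ)) σ + spinAt z σ) := funext (agreeIndicator_insert_sdiff hz)
  have mz := measurable_spinAt (V := V) z
  have mFz : Measurable (fun σ => F σ * spinAt z σ) := hF.mul mz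
  have m1 : Measurable (fun σ => F σ + F σ * spinAt z σ) := hF.add mFz
  have m2 : Measurable (fun σ => (fun _ => (1 : ℝ)) σ + spinAt z σ) := measurable_const.add mz
  rw [hnum, isingExpect_const_mul' _ _ _ _ β _ m1, isingExpect_add' _ _ _ _ β hF mFz] at hcond
  rw [hden, isingExpect_const_mul' _ _ _ _ β _ m2,
    isingExpect_add' _ _ _ _ β measurable_const mz, isingExpect_const] at hcond
  have hp := one_add_isingExpect_spinAt_pos G hz β h
  rw [hcond, mul_div_mul_left _ _ (by norm_num : (2⁻¹ : ℝ) ≠ 0), div_mul_cancel₀ _ hp.ne']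

omit [DecidableEq V] [G.LocallyFinite] in
/-- The algebra of the one-site freezing step: GHS (`u₃ ≤ 0`), GKS II (`a, b ≥ 0`) and `1 + m_z ≥ 0`
give `(e_xy + e_xyz)(1 + m_z) - (m_x + e_xz)(m_y + e_yz) ≤ (e_xy - m_x m_y)(1 + m_z)²`; indeed
the difference of the two sides is `-(1 + m_z) u₃ + a b`. [folklore] -/
theorem trunc_cond_le_aux {exy exyz exz eyz mx my mz : ℝ}
    (hghs : exyz - exy * mz - exz * my - eyz * mx + 2 * (mx * my * mz) ≤ 0)
    (ha : 0 ≤ exz - mx * mz) (hb : 0 ≤ eyz - my * mz) (hz : 0 ≤ 1 + mz) :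
    (exy + exyz) * (1 + mz) - (mx + exz) * (my + eyz) ≤ (exy - mx * my) * (1 + mz) ^ 2 := by
  nlinarith [mul_nonneg ha hb, mul_nonneg hz (neg_nonneg.2 hghs)]

/-- **One-site freezing raises the truncated pair function** (GHS; Lebowitz 1974, §2, Remark (ii):
the truncated pair function decreases under added nonnegative fields, and freezing `σ_z = +1` is an
infinite field at `z`): for `β, h ≥ 0`, `z ∉ Λ'` and `x, y ∈ insert z Λ'`,
`⟨σ_x;σ_y⟩⁺_{Λ';β,h} ≤ ⟨σ_x;σ_y⟩⁺_{insert z Λ';β,h}`. Discrete proof: conditioning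
(`isingExpect_plus_cond`), GHS (`isingExpect_ghs`), FKG (`ising_fkg_holds`) and `trunc_cond_le_aux`.
[cite: Lebowitz1974, eq. (1.8) and §2, Remark (ii)] -/
theorem isingTrunc_plus_le_insert {β h : ℝ} (hβ : 0 ≤ β) (hh : 0 ≤ h) {Λ' : Finset V} {z : V}
    (hz : z ∉ Λ') {x y : V} (hx : x ∈ insert z Λ') (hy : y ∈ insert z Λ') :
    isingExpect G Λ' β h .plus (fun σ => spinAt x σ * spinAt y σ) -
        isingExpect G Λ' β h .plus (spinAt x) * isingExpect G Λ' β h .plus (spinAt y) ≤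
      isingExpect G (insert z Λ') β h .plus (fun σ => spinAt x σ * spinAt y σ) -
        isingExpect G (insert z Λ') β h .plus (spinAt x) *
          isingExpect G (insert z Λ') β h .plus (spinAt y) := by
  have mx := measurable_spinAt (V := V) x
  have my := measurable_spinAt (V := V) y
  have mzm := measurable_spinAt (V := V) z
  have hzm : z ∈ insert z Λ' := Finset.mem_insert_self z Λ'
  have hp := one_add_isingExpect_spinAt_pos G hz β h
  have hfkg := ising_fkg_holds G hβ (insert z Λ') h .plus
  have hghs := isingExpect_ghs G hβ hh (Or.inr rfl) hx hy hzm
  set E := isingExpect G (insert z Λ') β h .plus with hE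
  set E' := isingExpect G Λ' β h .plus with hE'
  have mxy : Measurable (fun σ => spinAt x σ * spinAt y σ) := mx.mul my
  have hxy : E' (fun σ => spinAt x σ * spinAt y σ) * (1 + E (spinAt z)) =
      E (fun σ => spinAt x σ * spinAt y σ) + E (fun σ => spinAt x σ * spinAt y σ * spinAt z σ) :=
    isingExpect_plus_cond G hz β h mxy
  have hx' : E' (spinAt x) * (1 + E (spinAt z)) = E (spinAt x) + E (fun σ => spinAt x σ * spinAt z σ) :=
    isingExpect_plus_cond G hz β h mx
  have hy' : E' (spinAt y) * (1 + E (spinAt z)) = E (spinAt y) + E (fun σ => spinAt y σ * spinAt z σ) :=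
    isingExpect_plus_cond G hz β h my
  have ha : 0 ≤ E (fun σ => spinAt x σ * spinAt z σ) - E (spinAt x) * E (spinAt z) :=
    sub_nonneg.2 (hfkg _ _ (spinAt_mono x) (spinAt_mono z) mx mzm)
  have hb : 0 ≤ E (fun σ => spinAt y σ * spinAt z σ) - E (spinAt y) * E (spinAt z) :=
    sub_nonneg.2 (hfkg _ _ (spinAt_mono y) (spinAt_mono z) my mzm)
  have key := trunc_cond_le_aux hghs ha hb hp.le
  set p := E (spinAt z) with hpdef
  set exy := E (fun σ => spinAt x σ * spinAt y σ)
  set exyz := E (fun σ => spinAt x σ * spinAt y σ * spinAt z σ)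
  set exz := E (fun σ => spinAt x σ * spinAt z σ)
  set eyz := E (fun σ => spinAt y σ * spinAt z σ)
  rw [(eq_div_iff hp.ne').2 hxy, (eq_div_iff hp.ne').2 hx', (eq_div_iff hp.ne').2 hy']
  have hrew : (exy + exyz) / (1 + p) - (E (spinAt x) + exz) / (1 + p) * ((E (spinAt y) + eyz) / (1 + p)) =
      ((exy + exyz) * (1 + p) - (E (spinAt x) + exz) * (E (spinAt y) + eyz)) / (1 + p) ^ 2 := by
    field_simp
  rw [hrew, div_le_iff₀ (by positivity)]
  exact key

/-- **Truncated plus correlations increase with the volume** (GHS; Lebowitz 1974, §2, Remark (ii),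
with the `+` boundary spins of `Λ₂ ∖ Λ₁` as infinite nonnegative fields): for `β, h ≥ 0`,
`Λ₁ ⊆ Λ₂` and `x, y ∈ Λ₁`, `⟨σ_xσ_y⟩⁺_{Λ₁} - ⟨σ_x⟩⁺_{Λ₁}⟨σ_y⟩⁺_{Λ₁} ≤ ⟨σ_xσ_y⟩⁺_{Λ₂} -
⟨σ_x⟩⁺_{Λ₂}⟨σ_y⟩⁺_{Λ₂}` (at `β, h`). By induction on `Λ₂ ∖ Λ₁` from `isingTrunc_plus_le_insert`.
[cite: Lebowitz1974, eq. (1.8) and §2, Remark (ii)] -/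
theorem isingTrunc_plus_mono_volume {β h : ℝ} (hβ : 0 ≤ β) (hh : 0 ≤ h) {Λ₁ Λ₂ : Finset V}
    (h12 : Λ₁ ⊆ Λ₂) {x y : V} (hx : x ∈ Λ₁) (hy : y ∈ Λ₁) :
    isingExpect G Λ₁ β h .plus (fun σ => spinAt x σ * spinAt y σ) -
        isingExpect G Λ₁ β h .plus (spinAt x) * isingExpect G Λ₁ β h .plus (spinAt y) ≤
      isingExpect G Λ₂ β h .plus (fun σ => spinAt x σ * spinAt y σ) -
        isingExpect G Λ₂ β h .plus (spinAt x) * isingExpect G Λ₂ β h .plus (spinAt y) := by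
  suffices H : ∀ s : Finset V, Disjoint s Λ₁ →
      isingExpect G Λ₁ β h .plus (fun σ => spinAt x σ * spinAt y σ) -
          isingExpect G Λ₁ β h .plus (spinAt x) * isingExpect G Λ₁ β h .plus (spinAt y) ≤
        isingExpect G (Λ₁ ∪ s) β h .plus (fun σ => spinAt x σ * spinAt y σ) -
          isingExpect G (Λ₁ ∪ s) β h .plus (spinAt x) * isingExpect G (Λ₁ ∪ s) β h .plus (spinAt y) by
    have := H (Λ₂ \ Λ₁) Finset.sdiff_disjoint
    rwa [Finset.union_sdiff_of_subset h12] at this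
  intro s
  induction s using Finset.induction_on with
  | empty => intro; simp
  | @insert z s hzs ih =>
    intro hdisj
    have hz1 : z ∉ Λ₁ := Finset.disjoint_left.1 hdisj (Finset.mem_insert_self z s)
    have hdisj' : Disjoint s Λ₁ := Finset.disjoint_of_subset_left (Finset.subset_insert z s) hdisj
    have hz' : z ∉ Λ₁ ∪ s := by simp [hz1, hzs]
    rw [Finset.union_insert]
    exact (ih hdisj').trans (isingTrunc_plus_le_insert G hβ hh hz'
      (Finset.mem_insert_of_mem (Finset.mem_union_left s hx))
      (Finset.mem_insert_of_mem (Finset.mem_union_left s hy)))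

/-- The same in the tree's pair notation: `⟨σ_xσ_y⟩⁺_{Λ₁} - ⟨σ_x⟩⁺_{Λ₁}⟨σ_y⟩⁺_{Λ₁}` with
`isingTwoPoint` / `isingCorr` singletons, nondecreasing in the volume (`x, y ∈ Λ₁ ⊆ Λ₂`, `β, h ≥ 0`).
[cite: Lebowitz1974, eq. (1.8) and §2, Remark (ii)] -/
theorem isingTwoPoint_trunc_plus_mono_volume {β h : ℝ} (hβ : 0 ≤ β) (hh : 0 ≤ h)
    {Λ₁ Λ₂ : Finset V} (h12 : Λ₁ ⊆ Λ₂) {x y : V} (hx : x ∈ Λ₁) (hy : y ∈ Λ₁) :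
    isingTwoPoint G Λ₁ β h .plus x y - isingCorr G Λ₁ β h .plus {x} * isingCorr G Λ₁ β h .plus {y} ≤
      isingTwoPoint G Λ₂ β h .plus x y -
        isingCorr G Λ₂ β h .plus {x} * isingCorr G Λ₂ β h .plus {y} := by
  simp only [isingTwoPoint, isingCorr, spinProduct_singleton]
  exact isingTrunc_plus_mono_volume G hβ hh h12 hx hy

end Literature.Probability.LatticeModels

end
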